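import Mathlib
import Literature.MathematicalPhysics.QuantumFieldTheory.Balaban1983to89.B6CoverTwoLevel
import Literature.MathematicalPhysics.QuantumFieldTheory.Balaban1983to89.B6Prop27TwoLevel

/-!
# `Balaban1983to89.B6CoverRealizes` — the two COORDINATISED COVER MODELS (`…B6CoverBox`, one level; `…B6CoverTwoLevel`,
two adjacent levels) REALISE the multiscale distance (2.46) of `…B6Geometry`: their posited metrics ARE the lengths of
shortest admissible contours of explicit contour systems, their metric binders ((2.54), d(y,y) = 0, d ≥ 0, (2.60)) are
RE-DERIVED BY NAME from the realisation, the metric form of condition (2.2) ∕ (len) of `…B6LevelGapMetric` and the box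
charts ∕ atlas of `…B6BoxCharts` are instantiated on them, the (2.66)-comparison d ≍ (L^jη)^{−1}|y − y′| is proved on the
two-level carrier ACROSS the interface, and Proposition 2.7 ∕ 2.3 at power p (`…B6Prop27Kernel`, `…B6Prop27TwoLevel`) is
delivered on both models with every cover ∕ metric binder discharged (B6 = T. Bałaban, *Propagators and renormalization
transformations for lattice gauge theories. II*, Commun. Math. Phys. **96**, 223–250 (1984) [Balaban1984PropagatorsII]).

CITATION HEADER (lean-in-tree rule 2026-08-18).  Cell `pub-balaban`, unit `b2b-balaban-b06-g19` (paper sub-cell B06,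
gen 19 — the owner lineage of `…B6CoverBox` (gen 17), `…B6CoverTwoLevel` (gen 18), `…B6Prop27Kernel` ∕
`…B6Prop27TwoLevel` (gen 16), which this NEW LEAF imports (the first two through `…B6CoverTwoLevel`) and does not
modify; it reuses BY NAME the contour systems ∕ realisation lemmas of `…B6Geometry` (`ContourSystem`, `Realizes`,
`triangle254_of_realizes`, `hyps266_of_realizes`, `ineq260_of_levelGap`), the metric form of (2.2) of
`…B6LevelGapMetric` (`BondScale22`, `Cond22`, `ineq260_of_cond22`) and the box charts ∕ atlases of `…B6BoxCharts`
(`IsBoxChart`, `Atlas`, `connected_of_atlas`, `dist246_le_of_chart`, `dist_le_of_linked_at`), all three of the pv08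
lineage and imported through `…B6CoverTwoLevel`).  Source: [B6] doi:10.1007/bf01240221, held
`paper:balaban1984-cmp96-propagators-rt-ii`, journal page = PDF page + 222; the quotations of pp. 224, 231, 232, 233,
234, 248, 249 below were read from the page renders `b2b-balaban-ref1/pages/1984-cmp96-propagators-rt-II/
1984-cmp96-propagators-rt-II-p002, p009, p010, p011, p012, p026, p027-x2.png` AS IMAGES this gen.  Cell rows: GAPS
C-b06g19-1 (this module), DIVERGENCE D-b06.39; census `HOME/b2b-balaban-b06-g18/CENSUS-B6-v1.4.md` (hypothesis H-B6.5,
residue (c) "the metric is posited" of both cover headers, and O-12 = Proposition 2.7 on the covers), which this module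
addresses; journal claim COVER-REALIZES.

THE PRINTED TEXT.  [B6] p. 224 [PDF 2]: *"(2.2) Ω_j = B^j(Ω_j^{(j)}), Ω_j^{(j)} ⊂ T^{(j)}_{L^jη} and it is a sum of big
blocks, (L^jη)^{−1}dist(Ω_j^c, Ω_{j+1}) > RM, M is a size of big blocks and R is a big positive integer which will be
fixed later."* and *"(2.4) Ω₁ = ⋃_{j=1}^k B^j(Λ_j), T = ⋃_{j=0}^k B^j(Λ_j), where B⁰(Λ₀) = Λ₀."*  p. 231 [PDF 9]:
*"𝔅 = ⋃_{j=0}^k Λ_j. (2.45) We will identify this set with the set of corresponding blocks. For an arbitrary contour Γ on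
the lattice T_η we put |Γ| = nη, where n is a number of bonds the contour Γ consists of. We will define a new distance
between two points of 𝔅. We consider a special class of contours Γ. They have the property that a part of Γ contained in
B^j(Λ_j) consists of bonds of the lattice Λ_j. Now we define d(y, y′) = inf_{Γ_{y,y′}} Σ_{j=0}^k (L^jη)^{−1}
|Γ_{y,y′} ∩ B^j(Λ_j)|, y, y′ ∈ 𝔅, (2.46) where the infimum is taken over all admissible contours described above, with
end-points y, y′."* … *"The surface Σ_j separates the sets B^j(Λ_j) and B^{j−1}(Λ_{j−1}). … Of course the infimum is
attained at some contour Γ_{y,y′}."*  p. 232 [PDF 10], (2.48): *"d(y, y′) ≥ (L^jη)^{−1}|Γ_{y,y₁}| + Σ_{l=1}^m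
(L^{j_l}η)^{−1}|Γ_{y_l,y′_l}| + Σ (L^{j_{l,l+1}}η)^{−1}|Γ_{y′_l,y_{l+1}}| ≥ (L^jη)^{−1}|y − y₁| + Σ (L^{j_l}η)^{−1}
|y_l − y′_l| + Σ (L^{j_{l,l+1}}η)^{−1}|y′_l − y_{l+1}|"*.  p. 233 [PDF 11]: *"d(y, y₁) + d(y₁, y₂) + … + d(y_{n−1}, y′) ≥
d(y, y′). (2.54) This is of course the triangle inequality for our distance."*; (2.57) *"(L^{j_{l,l+1}}η)^{−1}
|y′_l − y_{l+1}| > RM"* obtained *"from the condition (2.2) and … from the fact that they belong to different surfaces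
Σ_j"*.  p. 234 [PDF 12], Lemma 2.1: *"e^{−αδ₀d(y,y′)} ≤ e^{−αδ₀RM max{|j−j′|−1, 0}}, y ∈ Λ_j, y′ ∈ Λ_{j′}, (2.60)"*, and
the chain (2.66) with *"y″: (L^jη)^{−1}|y − y″| ≤ 2dM"* ending *"≤ O(1)(L^jη)² e^{−½δ₀d(y,y′)}|λ|"*.  p. 248 [PDF 26]:
*"|(QGQ*)(b, b′)| ≤ O(1)(L^jη)²(L^{j′}η)^{−d}e^{−δ₃d(b,b′)}, b ∈ Λ_j, b′ ∈ Λ_{j′}, (2.142)"*, *"Keeping the same notations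
as before we consider the operators C_□ = ((QG_□Q*)↾_□)^{−1}, C = Σ_{□∈𝒟} h_□C_□h_□. (2.143) At first let us
investigate bounds on C_□. We assume that we have the same geometric situation as previously"*.  p. 249 [PDF 27]:
*"|C_□(b, b′)| ≤ O(1)(L^jη)^{−d−2}e^{−δ₄(L^jη)^{−1}|b_− − b′_−|}, b, b′ ∈ 𝔅 ∩ □. (2.148) We form the equality for QGQ*C
in exactly the same way as in (2.82) replacing only in the definition of R_{□,□′} the operators Q′, G′(□̃)², G′² by Q,
G_□, G. We have the same estimates now as before, but with powers of scaling factors changed properly (we replace +4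
and −4 in (2.83) by +2 and −2), thus we have (2.85) and this implies Proposition 2.7. The operator (QGQ*)^{−1} is given
by the convergent expansions of the form (2.86), and it satisfies the bound |(QGQ*)^{−1}(b, b′)| ≤
O(1)(L^jη)^{−2}(L^{j′}η)^{−d}e^{−½δ₄d(b,b′)}, b ∈ Λ_j, b′ ∈ Λ_{j′}. (2.149)"*.

THE POINT.  Both coordinatised cover models carry a POSITED distance: `…B6CoverBox` (header (c)) *"THE METRIC is
posited as the ℓ¹ lattice distance in L^jη-units, which is (2.46) on a one-level box region by the staircase-walk
dictionary …; the formal identification with the realised metric of `…B6Geometry` is NOT made here"*, and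
`…B6CoverTwoLevel` takes d := the graph distance of its bond graph, proving (2.54) etc. directly.  Meanwhile the tree's
typed form of (2.46) is `…B6Geometry.Realizes g C` — d(y, y′) = the length of a shortest walk of the bond graph of a
`ContourSystem` — from which (2.54) (`triangle254_of_realizes`), (2.60) (`ineq260_of_levelGap`, with the walk form of
(2.2)∕(2.57)) and, given a drawing with (len) and the metric (2.2), the walk form itself (`…B6LevelGapMetric`) are
DERIVED.  THIS MODULE closes the residue: it builds the contour systems of the two models (`boxCS`: the box with its
Λ_j-bonds, one zone; `tlCS`: the two boxes with Λ_j-, Λ_{j+1}- and interface bonds, zones j ∕ j + 1), proves `Realizes`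
for both (`boxGeo_realizes` — the ℓ¹ lattice distance IS the graph distance of the box bond graph, `boxGraph_dist_eq`;
`tlGeo_realizes` — by construction), proves the separation and level-gap properties (trivial ∕ vacuous on ≤ 2 levels:
no admissible contour crosses two surfaces Σ), draws both carriers in ℝ^d at the spacing L^jη and proves (len)
(`boxCS_bondScale22`, `tlCS_bondScale22`) with (2.2) vacuous (`boxCS_cond22`, `tlCS_cond22`), RE-DERIVES the metric
binders of the Proposition 2.3 ∕ 2.6 ∕ 2.7 chains from the realisation and checks `rfl` that they are the SAME
propositions (and proofs) the cover modules proved by hand, builds the two-chart ATLAS of the two-level carrier and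
re-derives its connectivity from block data (an `example` over `connected_of_atlas`; the landed `graph_connected` is
the citable declaration), proves the (2.66)-comparison on the two-level carrier in BOTH
directions and ACROSS THE INTERFACE — (L^{j+1}η)^{−1}|y − y′|₁ ≤ d(y, y′) ≤ (L^jη)^{−1}|y − y′|₁ (`comparison266`; the
upper bound through the face point above the coarse site, `tdist_inl_inr_le`, via `dist_le_of_linked_at`) — and finally
delivers PROPOSITION 2.7 ∕ 2.3 AT POWER p on both models (`inverse_assembled_pow_box`, `inverse_assembled_pow_twoLevelBox`:
census O-12 on the covers) with the metric binders supplied by the realisation and every cover ∕ cube ∕ collar ∕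
lattice-sum binder discharged by the cover modules — only the analytic kernels, their printed majorants, the rates, the
threshold and «M large» remain, verbatim.

WHAT THIS MODULE PROVES (kernel-checked; no `sorry`, no axiom beyond Lean's three):
1. §1 the Λ_j-bond graph of a box (`boxGraph` = comap of ℤ^d along the coordinates), the box as a chart of itself
   (`boxChart`), reachability ∕ connectivity (`boxGraph_connected`), **graph distance = ℓ¹ lattice distance**
   (`boxGraph_dist_eq`: ≤ by the staircase of `…B6BoxCharts`, ≥ because the coordinate map is a homomorphism into ℤ^d and
   `latL1Dist_le_length`), hence `bdist_eq_dist`; the drawing `bposR` with one bond ↦ extent ≤ L^jη (`dist_bposR_le`).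
2. §2 `boxCS`, `boxGeo_realizes`, `boxCS_connected ∕ _separates ∕ _levelGap` (every N), `boxCS_bondScale22`,
   `boxCS_cond22`, and the re-derived binders ((2.54) as an `example`, `rfl`-equal to `B6CoverBox.boxGeo_triangle` —
   restating a landed theorem is not allowed, the landed one is cited), `boxGeo_hyps266`, `boxGeo_ineq260_of_realizes`
   (= `B6CoverBox.boxGeo_ineq260` by `rfl`), `boxGeo_ineq260_of_cond22`
   (the metric route, RM = N ∈ ℕ as printed: "R is a big positive integer", M a block size), `boxGeo_dist_le_latL1Dist`.
3. §3 on the two-level carrier `TL d a b` of `…B6CoverTwoLevel`: the Λ_j-length of a bond (`blen`: L for a Λ_{j+1}-bond,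
   1 otherwise) and ONE BOND MOVES EVERY COORDINATE BY AT MOST ITS LENGTH (`abs_pos_sub_le_of_adj`); the drawing `posR`
   and `dist_posR_le`; the contour system `tlCS` with `tlGeo_realizes` (`rfl`), `tlCS_connected`, `tlCS_separates`
   (Σ_{j+1} separates), `tlCS_levelGap` (every N), `tlCS_bondScale22` ((len)), `tlCS_cond22` ((2.2) vacuous), the
   re-derived (2.54) (an `example`, `rfl`-equal to `B6CoverTwoLevel.tlGeo_triangle`), `tlGeo_hyps266`,
   `tlGeo_ineq260_of_realizes` (= `…tlGeo_ineq260` by `rfl`), `tlGeo_ineq260_of_cond22`; the atlas `tlAtlas` (fine chart,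
   coarse chart), `tlAtlas_covers`, `tlAtlas_linked` (the corner interface bond), `tlAtlas_nerve_preconnected`, the
   connectivity of the bond graph from the atlas (an `example` over `connected_of_atlas`); the (2.66) comparisons
   `tdist_inl_inl_le`, `tdist_inr_inr_le`, `tdist_inl_inr_le` (across
   the interface, for coarse sites whose face point fits in the fine box), `latL1Dist_zv_le_latL1Dist_pos`,
   `tdist_le_latL1Dist_pos` (all pairs, for L·b ≤ a), `latL1Dist_pos_le` (‖Δx‖₁ ≤ L·d, the mechanism of (2.48), by the
   potential lemma of `…B6CoverTwoLevel`), `comparison266`.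
4. §4 `inverse_assembled_pow_box` and `inverse_assembled_pow_twoLevelBox`: the conclusions of
   `…B6Prop27Kernel.inverse_assembled_pow` ∕ `…B6Prop27TwoLevel.inverse_assembled_pow_twoLevel` (two-sided inverse of the
   assembled operator, its glued form (2.86) with the located remainder, uniqueness, and the kernel bound (2.87)∕(2.149)
   at power p: p = 2 Proposition 2.7, p = 4 Proposition 2.3) on `boxGeo` ∕ `tlGeo` with D, □_i, h_□, j_□, n₀, s, m_g and
   the (2.61)∕(2.63)-constants of the cover modules, the binders htri ∕ hrefl ∕ hd supplied by `…_realizes`.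
5. §5 `coverRealizes_nonvacuous`: the side conditions of this module and of both cover models hold together (d = 1,
   M = 4, n_f = 10, n_c = 5, n = 5, L = 2, so L·n_cM ≤ n_fM), with the realisations, the connectivity from the atlas,
   (len) and (2.66) both ways on that instance.

TYPING ∕ DIVERGENCE (D-b06.39).  (i) (2.46) weighs a bond of Λ_{j′} inside B^{j′}(Λ_{j′}) by (L^{j′}η)^{−1}·(its
length L^{j′}η) = 1, so on a region where every admissible bond lies in its own level's B^{j′} the printed d IS the
number of bonds of a shortest admissible contour = the graph distance of the bond graph; this is the reading of
`…B6Geometry.Realizes` (pv08, D-pv08g2.1) and of both models, now identified formally.  The interface bonds of the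
two-level model (fine face ↔ coarse face, Λ_j-length 1) are counted in B^j(Λ_j) (weight 1) — a convention of the model
where the print is silent on bonds crossing Σ_{j+1}.  (ii) (len) is proved for the drawing at spacing L^jη with the sup
metric of ℝ^d (Mathlib's `dist` on `Fin d → ℝ`); any norm making a unit lattice bond of length ≤ 1 would do.  (iii) On
≤ 2 adjacent levels the walk form of (2.2) (`LevelGap`) and its metric form (`Cond22`) are VACUOUS (no zone strictly
between two zones) — so (2.60) holds there with ANY R; the content of (2.2) starts at three levels, which these models
do not carry (census: k-level model deferred).  (iv) The upper (2.66)-comparison across the interface needs the coarse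
box to fit under the fine face (L·b ≤ a; on the cover model L·n_c ≤ n_f), since the contour climbs to the face point
(0, L·i′) of the fine box; the lower comparison ‖Δx‖₁ ≤ L·d holds unconditionally.  O(1) = 1 upward and L downward —
the print's O(1) in (2.66) is level-local ((L^jη)^{−1}|y − y″| with y, y″ in one cube), where both constants are 1
(`tdist_inl_inl_le`, `tdist_inr_inr_le` with `latL1Dist_zv_le_latL1Dist_pos`).  (v) Proposition 2.7 is delivered, as
upstream, as the (2.82)–(2.87) Neumann-series chain at power p with the printed inputs (2.142)-type majorants of the
assembled kernel and of the cube kernels, the change-of-domain majorant, (2.148), (2.70) and «M large» kept as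
hypotheses VERBATIM; nothing analytic is added here.  (vi) M = m ∈ ℕ, m ≥ 1; L ∈ ℕ, L ≥ 2 on the two-level model (L ≥ 1
real on the box model); RM ≥ 0.

HONEST SCOPE.  Kernel bookkeeping at fixed lattice spacing on finite one- and two-level models: it certifies that the
coordinatised covers on which the Proposition 2.3 binders were discharged (gens 17, 18) are instances of the tree's
typed multiscale geometry (2.46) — so every metric consequence proved abstractly from the realisation applies to them by
name — and that the Proposition 2.7 ∕ 2.3 power-p chain runs on them with only the analytic inputs left.  It is NOT the
k-level statement on T_η (no model with ≥ 3 levels, where (2.2) has content, is built), NOT a continuum or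
ultraviolet-stability statement, and NOT progress on any Clay problem.
-/

namespace Literature.MathematicalPhysics.QuantumFieldTheory.Balaban1983to89.B6CoverRealizes

open Finset Real
open Literature.Probability.LatticeModels (Site zdGraph zdGraph_adj_iff latL1Dist)
open B6RandomWalk (Ineq260 Triangle254)
open B6Expansion282 (kerOp locOp Cglued R282)
open B6Prop23Chain (mat)
open B6Lemma21Repaired (Ineq261With Ineq263With)
open B6Ineq268 (LevelSep)
open B6Geometry (ContourSystem dist246 Realizes Separates LevelGap triangle254_of_realizes hyps266_of_realizes
  ineq260_of_levelGap dist_self_of_realizes dist_nonneg_of_realizes dist_comm_of_realizes separates_of_levelGap)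
open B6LevelGapMetric (BondScale BondScale22 Cond22 ZoneSep ineq260_of_cond22 levelGap_of_cond22)
open B6BoxCharts (IsBoxChart Atlas cboxClosed_Icc reachable_of_chart dist_le_latL1Dist_of_chart latL1Dist_le_length
  zdGraph_dist_eq_latL1Dist connected_of_atlas bond_connected_of_atlas dist_le_of_linked_at dist246_le_of_chart
  latL1Dist_self latL1Dist_comm)
open B6CoverTwoLevel (zv zv_step clampBox zv_clampBox clampBox_zv zv_mem_Icc)
open B6Prop27Kernel (K285P K285P_four inverse_assembled_pow)
open B6Prop27TwoLevel (K285TLP K285TLP_four inverse_assembled_pow_twoLevel)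

/-! ## §1  The Λ_j-bond graph of a box and its graph distance = the ℓ¹ lattice distance -/

section BoxGraph

variable {d : ℕ}

/-- The Λ_j-BOND GRAPH of the box {0, …, S − 1}^d: x ∼ y iff their integer coordinate vectors are nearest neighbours
of ℤ^d — *"a part of Γ contained in B^j(Λ_j) consists of bonds of the lattice Λ_j"*. [cite: Balaban1984PropagatorsII, (2.46) p.231] -/
noncomputable def boxGraph (d S : ℕ) : SimpleGraph (Fin d → Fin S) := (zdGraph d).comap zv

/-- Adjacency of the box bond graph is adjacency of the coordinate vectors in ℤ^d. [folklore] -/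
theorem boxGraph_adj {S : ℕ} (x y : Fin d → Fin S) : (boxGraph d S).Adj x y ↔ (zdGraph d).Adj (zv x) (zv y) :=
  Iff.rfl

/-- The coordinate map is a graph homomorphism into ℤ^d. [folklore] -/
def zvHom (d S : ℕ) : boxGraph d S →g zdGraph d where
  toFun := zv
  map_rel' := fun h => h

/-- The box is a box chart of its own bond graph (chart map = clamping). [cite: Balaban1984PropagatorsII, p.231] -/
theorem boxChart (N : ℕ) : IsBoxChart (boxGraph d (N + 1)) (Set.Icc 0 (fun _ => (N : ℤ))) (clampBox N) := by
  refine ⟨cboxClosed_Icc _ _, fun z z' hz hz' h => ?_⟩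
  show (zdGraph d).Adj (zv (clampBox N z)) (zv (clampBox N z'))
  rwa [zv_clampBox hz, zv_clampBox hz']

/-- Any two points of the box are joined by a contour of Λ_j-bonds inside the box (*"Of course the infimum is attained
at some contour Γ_{y,y′}"*). [cite: Balaban1984PropagatorsII, p.231] -/
theorem boxGraph_reachable (N : ℕ) (x y : Fin d → Fin (N + 1)) : (boxGraph d (N + 1)).Reachable x y := by
  have := reachable_of_chart (boxChart (d := d) N) (zv_mem_Icc x) (zv_mem_Icc y)
  rwa [clampBox_zv, clampBox_zv] at this

/-- The box bond graph is connected. [cite: Balaban1984PropagatorsII, p.231] -/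
theorem boxGraph_connected (N : ℕ) : (boxGraph d (N + 1)).Connected :=
  (SimpleGraph.connected_iff _).2 ⟨fun x y => boxGraph_reachable N x y, ⟨fun _ => 0⟩⟩

/-- **The graph distance of the box bond graph is the ℓ¹ lattice distance** (a staircase inside the box realises it; no
contour of ℤ^d is shorter). [cite: Balaban1984PropagatorsII, (2.46) p.231] -/
theorem boxGraph_dist_eq (N : ℕ) (x y : Fin d → Fin (N + 1)) :
    (boxGraph d (N + 1)).dist x y = latL1Dist (zv x) (zv y) := by
  refine le_antisymm ?_ ?_
  · have := dist_le_latL1Dist_of_chart (boxChart (d := d) N) (zv_mem_Icc x) (zv_mem_Icc y)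
    rwa [clampBox_zv, clampBox_zv] at this
  · obtain ⟨p, hp⟩ := (boxGraph_reachable N x y).exists_walk_length_eq_dist
    rw [← hp, ← SimpleGraph.Walk.length_map (zvHom d (N + 1)) p]
    exact latL1Dist_le_length _

/-- The ℓ¹ lattice distance of the coordinate vectors, as a real number, is the distance `bdist` of the one-level box
model `…B6CoverBox`. [folklore] -/
theorem cast_latL1Dist_zv {S : ℕ} (x y : Fin d → Fin S) :
    ((latL1Dist (zv x) (zv y) : ℕ) : ℝ) = B6CoverBox.bdist x y := by
  simp only [latL1Dist, B6CoverBox.bdist, B6CoverBox.crd, zv, Nat.cast_sum, Nat.cast_natAbs, Int.cast_abs,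
    Int.cast_sub, Int.cast_natCast]

/-- **The posited distance of the one-level box model IS the realised distance (2.46)**: bdist = the graph distance of
the Λ_j-bond graph of the box. [cite: Balaban1984PropagatorsII, (2.46) p.231] -/
theorem bdist_eq_dist (N : ℕ) (x y : Fin d → Fin (N + 1)) :
    B6CoverBox.bdist x y = ((boxGraph d (N + 1)).dist x y : ℝ) := by
  rw [boxGraph_dist_eq, cast_latL1Dist_zv]

/-- The box DRAWN IN ℝ^d (sup metric) on the lattice L^jηℤ^d of Λ_j: x ↦ L^jη·x. [cite: Balaban1984PropagatorsII, (2.1) p.224] -/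
noncomputable def bposR {S : ℕ} (L : ℝ) (j : ℕ) (η : ℝ) (x : Fin d → Fin S) : Fin d → ℝ :=
  fun μ => L ^ j * η * ((zv x μ : ℤ) : ℝ)

/-- A Λ_j-bond of the box has extent ≤ L^jη in the drawing (one coordinate moves by one lattice spacing); L, η ≥ 0.
[cite: Balaban1984PropagatorsII, p.231 + (2.1) p.224] -/
theorem dist_bposR_le {S : ℕ} {L : ℝ} {j : ℕ} {η : ℝ} (hL : 0 ≤ L) (hη : 0 ≤ η) {x x' : Fin d → Fin S}
    (h : (boxGraph d S).Adj x x') : dist (bposR L j η x) (bposR L j η x') ≤ L ^ j * η := by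
  obtain ⟨μ₀, h1, h2⟩ := zv_step h
  refine (dist_pi_le_iff (by positivity)).2 fun μ => ?_
  rw [Real.dist_eq, bposR, bposR, ← mul_sub, abs_mul, abs_of_nonneg (by positivity), ← Int.cast_sub, ← Int.cast_abs]
  by_cases hμ : μ = μ₀
  · subst hμ
    rw [h2, Int.cast_one, mul_one]
  · rw [h1 μ hμ, sub_self, abs_zero, Int.cast_zero, mul_zero]
    positivity

end BoxGraph

/-! ## §2  The one-level box model as a contour system; its metric binders re-derived BY NAME from the realisation -/

section BoxCS

variable (d n m j kk : ℕ) (L η R : ℝ)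

open B6CoverBox (bdist boxGeo Kbox Kbox_nonneg boxGeo_levelSep boxGeo_ineq261With boxGeo_ineq263With hprof
  sum_hprof_sq card_filter_hprof_ne_zero_le abs_hprof_sub_le cubeInd_zero_or_one cubeInd_mul_hprof)

/-- **The one-level box model as a contour system of `…B6Geometry`**: block points = the box itself, admissible bonds =
its Λ_j-bonds, every point in zone j. [cite: Balaban1984PropagatorsII, (2.45)–(2.46) p.231] -/
noncomputable def boxCS : ContourSystem (boxGeo d n m j kk L η R) where
  Pt := Fin d → Fin (n * m + 1)
  bond := boxGraph d (n * m + 1)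
  ι := fun y => y
  zone := fun _ => j
  zone_ι := fun _ => rfl

/-- **`boxGeo` REALISES (2.46)**: its distance is the length of a shortest admissible contour of the contour system.
[cite: Balaban1984PropagatorsII, (2.46) p.231] -/
theorem boxGeo_realizes : Realizes (boxGeo d n m j kk L η R) (boxCS d n m j kk L η R) :=
  fun y y' => bdist_eq_dist (n * m) y y'

/-- Admissible contours exist (*"the infimum is attained"*). [cite: Balaban1984PropagatorsII, p.231] -/
theorem boxCS_connected : (boxCS d n m j kk L η R).bond.Connected := boxGraph_connected (n * m)

/-- The zones of the two ends of a bond differ by at most one (trivially: one zone). [cite: Balaban1984PropagatorsII, p.231] -/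
theorem boxCS_separates : Separates (boxCS d n m j kk L η R).bond (boxCS d n m j kk L η R).zone :=
  fun _ _ _ => ⟨Nat.le_succ _, Nat.le_succ _⟩

/-- The level-gap hypothesis of `…B6Geometry.ineq260_of_levelGap` holds for EVERY N on one level (no contour crosses
two surfaces Σ). [cite: Balaban1984PropagatorsII, (2.57) p.233] -/
theorem boxCS_levelGap (N : ℕ) : LevelGap (boxCS d n m j kk L η R).bond (boxCS d n m j kk L η R).zone N :=
  fun _ _ _ hu hx _ => absurd (hu.trans hx) (lt_irrefl _)

/-- **(len) on the box model** (`…B6LevelGapMetric.BondScale22`): drawn on L^jηℤ^d, every Λ_j-bond has extent ≤ L^jη =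
L^{min(j,j)}η; L, η ≥ 0. [cite: Balaban1984PropagatorsII, p.231 + (2.1) p.224] -/
theorem boxCS_bondScale22 (hL : 0 ≤ L) (hη : 0 ≤ η) : BondScale22 (boxCS d n m j kk L η R) (bposR L j η) := by
  intro y y' h
  show dist (bposR L j η y) (bposR L j η y') ≤ L ^ (min j j) * η
  rw [min_self]
  exact dist_bposR_le hL hη h

/-- **(2.2) on the box model is VACUOUS** (one zone): `Cond22` holds for any drawing. [cite: Balaban1984PropagatorsII, (2.2) p.224] -/
theorem boxCS_cond22 {X : Type*} [PseudoMetricSpace X] (p : (Fin d → Fin (n * m + 1)) → X) :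
    Cond22 (boxCS d n m j kk L η R) p :=
  fun _ _ _ hu hx => absurd (hu.trans hx) (lt_irrefl _)

/- (2.54) on the box model RE-DERIVED from the realisation (`…B6Geometry.triangle254_of_realizes`) — the same
proposition, and by proof irrelevance the same proof, as the hand-proved `…B6CoverBox.boxGeo_triangle` (an `example`,
not a theorem: the landed declaration is the one to cite). [cite: Balaban1984PropagatorsII, (2.54) p.233] -/
example : Triangle254 (boxGeo d n m j kk L η R) :=
  triangle254_of_realizes (boxGeo_realizes d n m j kk L η R) (boxCS_connected d n m j kk L η R)

example : triangle254_of_realizes (boxGeo_realizes d n m j kk L η R) (boxCS_connected d n m j kk L η R) =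
    B6CoverBox.boxGeo_triangle d n m j kk L η R := rfl

/-- The three metric hypotheses of the (2.66)∕(2.76) chain (`…B6Geometry.hyps266_of_realizes`) on the box model.
[cite: Balaban1984PropagatorsII, (2.54) p.233 + (2.46) p.231] -/
theorem boxGeo_hyps266 : Triangle254 (boxGeo d n m j kk L η R) ∧ (∀ y, (boxGeo d n m j kk L η R).dist y y = 0) ∧
    (∀ y y', 0 ≤ (boxGeo d n m j kk L η R).dist y y') :=
  hyps266_of_realizes (boxGeo_realizes d n m j kk L η R) (boxCS_connected d n m j kk L η R)

/-- (2.60) on the box model RE-DERIVED from the realisation and the level gap (`…B6Geometry.ineq260_of_levelGap`, with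
N := ⌈RM⌉); the same proposition as `…B6CoverBox.boxGeo_ineq260`. [cite: Balaban1984PropagatorsII, (2.60) p.234] -/
theorem boxGeo_ineq260_of_realizes {δ₀ α : ℝ} (hαδ : 0 ≤ α * δ₀) : Ineq260 (boxGeo d n m j kk L η R) δ₀ α :=
  ineq260_of_levelGap (boxGeo_realizes d n m j kk L η R) (boxCS_connected d n m j kk L η R)
    (boxCS_levelGap d n m j kk L η R ⌈R * (m : ℝ)⌉₊) (Nat.le_ceil _) hαδ

/-- (2.60) on the box model by the METRIC route of `…B6LevelGapMetric.ineq260_of_cond22` ((len) proved, (2.2) vacuous),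
for L ≥ 1, η ≥ 0 and RM = N ∈ ℕ. [cite: Balaban1984PropagatorsII, (2.60) p.234 + (2.2) p.224] -/
theorem boxGeo_ineq260_of_cond22 (hL : 1 ≤ L) (hη : 0 ≤ η) {N : ℕ} (hN : (N : ℝ) = R * m) {δ₀ α : ℝ}
    (hαδ : 0 ≤ α * δ₀) : Ineq260 (boxGeo d n m j kk L η R) δ₀ α :=
  ineq260_of_cond22 (boxGeo_realizes d n m j kk L η R) (boxCS_connected d n m j kk L η R) (bposR L j η) hL hη
    (boxCS_bondScale22 d n m j kk L η R (zero_le_one.trans hL) hη) (boxCS_cond22 d n m j kk L η R _) hN hαδ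

/-- **The (2.66) comparison on the box model, in-box case, by name** (`…B6BoxCharts.dist246_le_of_chart`):
d(y, y″) ≤ ‖x(y) − x(y″)‖₁ (here in fact an equality, `bdist_eq_dist`). [cite: Balaban1984PropagatorsII, (2.66) p.234 + (2.46) p.231] -/
theorem boxGeo_dist_le_latL1Dist (y y'' : Fin d → Fin (n * m + 1)) :
    (boxGeo d n m j kk L η R).dist y y'' ≤ (latL1Dist (zv y) (zv y'') : ℝ) :=
  dist246_le_of_chart (boxGeo_realizes d n m j kk L η R) (boxChart (d := d) (n * m)) (zv_mem_Icc y) (zv_mem_Icc y'')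
    (clampBox_zv y).symm (clampBox_zv y'').symm

example {δ₀ α : ℝ} (h : 0 ≤ α * δ₀) :
    boxGeo_ineq260_of_realizes d n m j kk L η R h = B6CoverBox.boxGeo_ineq260 d n m j kk L η R h := rfl

end BoxCS

/-! ## §3  The two-level model as a contour system: realisation, (len), (2.2)-vacuity, an atlas, (2.66) both ways -/

section TwoLevel

variable {d a b : ℕ} [NeZero d]

open B6CoverTwoLevel (TL pos graph tdist chart_inl chart_inr adj_corner graph_connected tdist_self tdist_comm
  tdist_nonneg tdist_triangle ff pos_inl pos_inr_zero pos_inr_of_ne abs_sub_le_mul_tdist sum_abs_ff_sub_le_of_adj)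

/-! ### One bond moves the position by 1 (Λ_j- and interface bonds) or by L (Λ_{j+1}-bonds), coordinatewise -/

/-- The Λ_j-LENGTH of a bond of the two-level carrier: L for a Λ_{j+1}-bond, 1 for a Λ_j-bond or an interface bond
(|Γ| = nη: a bond of Λ_{j′} has length L^{j′}η). [cite: Balaban1984PropagatorsII, p.231] -/
def blen (L : ℕ) : TL d a b → TL d a b → ℕ
  | Sum.inr _, Sum.inr _ => L
  | _, _ => 1

omit [NeZero d] in
/-- The bond length is symmetric. [folklore] -/
theorem blen_comm (L : ℕ) (y y' : TL d a b) : blen L y y' = blen L y' y := by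
  rcases y with _ | _ <;> rcases y' with _ | _ <;> rfl

/-- A bond from a fine site moves every coordinate of the position by at most 1. [cite: Balaban1984PropagatorsII, (2.46) p.231] -/
theorem abs_pos_sub_le_one_of_bond_inl (L : ℕ) {x : Fin d → Fin (a + 1)} :
    ∀ {y' : TL d a b}, B6CoverTwoLevel.bond L (Sum.inl x) y' → ∀ μ, |pos L (Sum.inl x : TL d a b) μ - pos L y' μ| ≤ 1
  | Sum.inl x', h, μ => by
    obtain ⟨μ₀, h1, h2⟩ := zv_step h
    rw [pos_inl, pos_inl]
    by_cases hμ : μ = μ₀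
    · subst hμ; exact h2.le
    · rw [h1 μ hμ, sub_self, abs_zero]; exact zero_le_one
  | Sum.inr i, h, μ => by
    obtain ⟨hx, hi, hrest⟩ := h
    by_cases hμ : μ = 0
    · subst hμ
      rw [pos_inl, pos_inr_zero]
      simp [zv, hx, hi]
    · rw [pos_inl, pos_inr_of_ne L i hμ]
      simp [zv, hrest μ hμ]

/-- A Λ_{j+1}-bond moves every coordinate of the position by at most L. [cite: Balaban1984PropagatorsII, (2.46) p.231] -/
theorem abs_pos_sub_le_of_bond_inr (L : ℕ) {i i' : Fin d → Fin (b + 1)}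
    (h : B6CoverTwoLevel.bond L (Sum.inr i : TL d a b) (Sum.inr i')) (μ : Fin d) :
    |pos L (Sum.inr i : TL d a b) μ - pos L (Sum.inr i' : TL d a b) μ| ≤ L := by
  obtain ⟨μ₀, h1, h2⟩ := zv_step h
  simp only [zv] at h1 h2
  have hL : (0 : ℤ) ≤ L := Int.natCast_nonneg _
  by_cases hμ0 : μ = 0
  · subst hμ0
    rw [pos_inr_zero, pos_inr_zero,
      show -1 - (L : ℤ) * ((i 0 : ℕ) : ℤ) - (-1 - (L : ℤ) * ((i' 0 : ℕ) : ℤ)) =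
        -((L : ℤ) * (((i 0 : ℕ) : ℤ) - ((i' 0 : ℕ) : ℤ))) by ring, abs_neg, abs_mul, abs_of_nonneg hL]
    by_cases h0 : (0 : Fin d) = μ₀
    · subst h0; rw [h2, mul_one]
    · rw [h1 0 h0, sub_self, abs_zero, mul_zero]; exact hL
  · rw [pos_inr_of_ne L i hμ0, pos_inr_of_ne L i' hμ0, ← mul_sub, abs_mul, abs_of_nonneg hL]
    by_cases h0 : μ = μ₀
    · subst h0; rw [h2, mul_one]
    · rw [h1 μ h0, sub_self, abs_zero, mul_zero]; exact hL

/-- An (oriented) bond moves every coordinate of the position by at most its Λ_j-length. [cite: Balaban1984PropagatorsII, (2.46) p.231] -/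
theorem abs_pos_sub_le_of_bond (L : ℕ) :
    ∀ {y y' : TL d a b}, B6CoverTwoLevel.bond L y y' → ∀ μ, |pos L y μ - pos L y' μ| ≤ (blen L y y' : ℤ)
  | Sum.inl _, Sum.inl _, h, μ => by simpa [blen] using abs_pos_sub_le_one_of_bond_inl L h μ
  | Sum.inl _, Sum.inr _, h, μ => by simpa [blen] using abs_pos_sub_le_one_of_bond_inl L h μ
  | Sum.inr _, Sum.inr _, h, μ => by simpa [blen] using abs_pos_sub_le_of_bond_inr L h μ
  | Sum.inr _, Sum.inl _, h, _ => False.elim h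

/-- A bond of the two-level graph moves every coordinate of the position by at most its Λ_j-length.
[cite: Balaban1984PropagatorsII, (2.46) p.231] -/
theorem abs_pos_sub_le_of_adj {L : ℕ} {y y' : TL d a b} (h : (graph L).Adj y y') (μ : Fin d) :
    |pos L y μ - pos L y' μ| ≤ (blen L y y' : ℤ) := by
  rw [B6CoverTwoLevel.graph, SimpleGraph.fromRel_adj] at h
  rcases h.2 with h' | h'
  · exact abs_pos_sub_le_of_bond L h' μ
  · rw [abs_sub_comm, blen_comm]; exact abs_pos_sub_le_of_bond L h' μ

/-! ### (len): the carrier drawn in ℝ^d at the fine spacing L^jη -/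

/-- The sites DRAWN IN ℝ^d (sup metric): position in Λ_j-units times the fine spacing L^jη — the fine box on the
lattice L^jηℤ^d = Λ_j's lattice, the coarse box on L^{j+1}ηℤ^d. [cite: Balaban1984PropagatorsII, (2.1)–(2.3) p.224] -/
noncomputable def posR (L j : ℕ) (η : ℝ) (y : TL d a b) : Fin d → ℝ := fun μ => (L : ℝ) ^ j * η * ((pos L y μ : ℤ) : ℝ)

/-- A bond of Λ_j-length ℓ ∈ {1, L} has Euclidean (sup) extent ≤ L^jη·ℓ in the drawing. [cite: Balaban1984PropagatorsII, p.231] -/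
theorem dist_posR_le {L j : ℕ} {η : ℝ} (hη : 0 ≤ η) {y y' : TL d a b} (h : (graph L).Adj y y') :
    dist (posR L j η y) (posR L j η y') ≤ (L : ℝ) ^ j * η * blen L y y' := by
  refine (dist_pi_le_iff (by positivity)).2 fun μ => ?_
  rw [Real.dist_eq, posR, posR, ← mul_sub, abs_mul, abs_of_nonneg (by positivity), ← Int.cast_sub, ← Int.cast_abs]
  exact mul_le_mul_of_nonneg_left (by exact_mod_cast abs_pos_sub_le_of_adj h μ) (by positivity)

/-! ### The contour system of the two-level cover model -/

section TLCS

variable (d : ℕ) [NeZero d] (nf nc m L j kk : ℕ) (η R : ℝ)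

open B6CoverTwoLevel (tlGeo tlGeo_levelSep tlGeo_ineq261With tlGeo_ineq263With Ktl Ktl_nonneg Idx hfun
  sum_hfun_sq card_filter_hfun_ne_zero_le abs_hfun_sub_le cubeInd_mul_hfun)

/-- **The two-level cover model as a contour system of `…B6Geometry`**: block points = the two boxes, admissible bonds
= the Λ_j-, Λ_{j+1}- and interface bonds (`…B6CoverTwoLevel.graph`), zones j on the fine box and j + 1 on the coarse box.
[cite: Balaban1984PropagatorsII, (2.45)–(2.46) p.231] -/
noncomputable def tlCS : ContourSystem (tlGeo d nf nc m L j kk η R) where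
  Pt := TL d (nf * m) (nc * m)
  bond := graph L
  ι := fun y => y
  zone := fun y => Sum.elim (fun _ => j) (fun _ => j + 1) y
  zone_ι := fun _ => rfl

/-- The zone of a fine point is j. [folklore] -/
theorem tlCS_zone_inl (x : Fin d → Fin (nf * m + 1)) : (tlCS d nf nc m L j kk η R).zone (Sum.inl x) = j := rfl

/-- The zone of a coarse point is j + 1. [folklore] -/
theorem tlCS_zone_inr (i : Fin d → Fin (nc * m + 1)) : (tlCS d nf nc m L j kk η R).zone (Sum.inr i) = j + 1 := rfl

/-- **`tlGeo` REALISES (2.46)** — by construction: its distance IS the graph distance of the bond graph.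
[cite: Balaban1984PropagatorsII, (2.46) p.231] -/
theorem tlGeo_realizes : Realizes (tlGeo d nf nc m L j kk η R) (tlCS d nf nc m L j kk η R) := fun _ _ => rfl

/-- Admissible contours exist (`…B6CoverTwoLevel.graph_connected`). [cite: Balaban1984PropagatorsII, p.231] -/
theorem tlCS_connected : (tlCS d nf nc m L j kk η R).bond.Connected := graph_connected L

/-- **Σ_{j+1} separates**: the zones of the two ends of an admissible bond differ by at most one (*"The surface Σ_j
separates the sets B^j(Λ_j) and B^{j−1}(Λ_{j−1})"*). [cite: Balaban1984PropagatorsII, p.231] -/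
theorem tlCS_separates : Separates (tlCS d nf nc m L j kk η R).bond (tlCS d nf nc m L j kk η R).zone := by
  rintro (x | i) (x' | i') - <;> simp only [tlCS_zone_inl, tlCS_zone_inr] <;> omega

/-- The level-gap hypothesis of `…B6Geometry.ineq260_of_levelGap` holds for EVERY N on two adjacent levels (no contour
crosses two different surfaces; cf. (2.57)). [cite: Balaban1984PropagatorsII, (2.57) p.233] -/
theorem tlCS_levelGap (N : ℕ) : LevelGap (tlCS d nf nc m L j kk η R).bond (tlCS d nf nc m L j kk η R).zone N := by
  rintro i (x | i₁) (x' | i₂) hu hx p <;> simp only [tlCS_zone_inl, tlCS_zone_inr] at hu hx <;> omega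

/-- **(len) on the model** (`…B6LevelGapMetric.BondScale22`): drawn at the fine spacing, every admissible bond between
zones j₁, j₂ has extent ≤ L^{min(j₁,j₂)}η (Λ_j- and interface bonds L^jη, Λ_{j+1}-bonds L^{j+1}η); η ≥ 0.
[cite: Balaban1984PropagatorsII, p.231 + (2.1) p.224] -/
theorem tlCS_bondScale22 (hη : 0 ≤ η) : BondScale22 (tlCS d nf nc m L j kk η R) (posR L j η) := by
  intro y y' h
  refine (dist_posR_le hη h).trans ?_
  rcases y with x | i <;> rcases y' with x' | i'
  · show (L : ℝ) ^ j * η * ((1 : ℕ) : ℝ) ≤ (L : ℝ) ^ (min j j) * η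
    rw [Nat.cast_one, mul_one, min_self]
  · show (L : ℝ) ^ j * η * ((1 : ℕ) : ℝ) ≤ (L : ℝ) ^ (min j (j + 1)) * η
    rw [Nat.cast_one, mul_one, min_eq_left (Nat.le_succ j)]
  · show (L : ℝ) ^ j * η * ((1 : ℕ) : ℝ) ≤ (L : ℝ) ^ (min (j + 1) j) * η
    rw [Nat.cast_one, mul_one, min_eq_right (Nat.le_succ j)]
  · show (L : ℝ) ^ j * η * ((L : ℕ) : ℝ) ≤ (L : ℝ) ^ (min (j + 1) (j + 1)) * η
    rw [min_self, pow_succ]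
    exact le_of_eq (by ring)

/-- **(2.2) on the model is VACUOUS**: two adjacent levels have no pair of points in zones j₁ < i < j₂, so `Cond22`
holds for any drawing. [cite: Balaban1984PropagatorsII, (2.2) p.224] -/
theorem tlCS_cond22 {X : Type*} [PseudoMetricSpace X] (p : TL d (nf * m) (nc * m) → X) :
    Cond22 (tlCS d nf nc m L j kk η R) p := by
  rintro i (x | i₁) (x' | i₂) hu hx <;> simp only [tlCS_zone_inl, tlCS_zone_inr] at hu hx <;> omega

/- (2.54) on the two-level model RE-DERIVED from the realisation — the same proposition (and proof) as the hand-proved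
`…B6CoverTwoLevel.tlGeo_triangle` (an `example`; cite the landed declaration). [cite: Balaban1984PropagatorsII, (2.54) p.233] -/
example : Triangle254 (tlGeo d nf nc m L j kk η R) :=
  triangle254_of_realizes (tlGeo_realizes d nf nc m L j kk η R) (tlCS_connected d nf nc m L j kk η R)

example : triangle254_of_realizes (tlGeo_realizes d nf nc m L j kk η R) (tlCS_connected d nf nc m L j kk η R) =
    B6CoverTwoLevel.tlGeo_triangle d nf nc m L j kk η R := rfl

/-- The three metric hypotheses of the (2.66)∕(2.76) chain on the two-level model. [cite: Balaban1984PropagatorsII, (2.54) p.233 + (2.46) p.231] -/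
theorem tlGeo_hyps266 : Triangle254 (tlGeo d nf nc m L j kk η R) ∧ (∀ y, (tlGeo d nf nc m L j kk η R).dist y y = 0) ∧
    (∀ y y', 0 ≤ (tlGeo d nf nc m L j kk η R).dist y y') :=
  hyps266_of_realizes (tlGeo_realizes d nf nc m L j kk η R) (tlCS_connected d nf nc m L j kk η R)

/-- (2.60) on the two-level model RE-DERIVED from the realisation and the level gap (N := ⌈RM⌉); the same proposition
as `…B6CoverTwoLevel.tlGeo_ineq260`. [cite: Balaban1984PropagatorsII, (2.60) p.234] -/
theorem tlGeo_ineq260_of_realizes {δ₀ α : ℝ} (hαδ : 0 ≤ α * δ₀) : Ineq260 (tlGeo d nf nc m L j kk η R) δ₀ α :=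
  ineq260_of_levelGap (tlGeo_realizes d nf nc m L j kk η R) (tlCS_connected d nf nc m L j kk η R)
    (tlCS_levelGap d nf nc m L j kk η R ⌈R * (m : ℝ)⌉₊) (Nat.le_ceil _) hαδ

/-- (2.60) on the two-level model by the METRIC route of `…B6LevelGapMetric.ineq260_of_cond22` ((len) proved, (2.2)
vacuous), for L ≥ 1, η ≥ 0 and RM = N ∈ ℕ. [cite: Balaban1984PropagatorsII, (2.60) p.234 + (2.2) p.224] -/
theorem tlGeo_ineq260_of_cond22 (hL : 1 ≤ L) (hη : 0 ≤ η) {N : ℕ} (hN : (N : ℝ) = R * m) {δ₀ α : ℝ}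
    (hαδ : 0 ≤ α * δ₀) : Ineq260 (tlGeo d nf nc m L j kk η R) δ₀ α :=
  ineq260_of_cond22 (tlGeo_realizes d nf nc m L j kk η R) (tlCS_connected d nf nc m L j kk η R) (posR L j η)
    (show (1 : ℝ) ≤ (L : ℝ) by exact_mod_cast hL) hη (tlCS_bondScale22 d nf nc m L j kk η R hη)
    (tlCS_cond22 d nf nc m L j kk η R _) hN hαδ

example {δ₀ α : ℝ} (h : 0 ≤ α * δ₀) :
    tlGeo_ineq260_of_realizes d nf nc m L j kk η R h = B6CoverTwoLevel.tlGeo_ineq260 d nf nc m L j kk η R h := rfl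

end TLCS

/-! ### The two boxes as an atlas of box charts; connectivity from block data -/

/-- **The atlas of the two-level carrier**: chart `false` = the fine box, chart `true` = the coarse box (each a box chart
by `…B6CoverTwoLevel.chart_inl ∕ chart_inr`). [cite: Balaban1984PropagatorsII, (2.4) p.224 + p.231] -/
noncomputable def tlAtlas (L : ℕ) : Atlas (graph L : SimpleGraph (TL d a b)) d Bool where
  box s := match s with
    | false => Set.Icc 0 (fun _ => (a : ℤ))
    | true => Set.Icc 0 (fun _ => (b : ℤ))
  φ s := match s with
    | false => fun z => Sum.inl (clampBox a z)
    | true => fun z => Sum.inr (clampBox b z)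
  chart s := match s with
    | false => chart_inl L
    | true => chart_inr L

/-- The two charts cover the carrier. [cite: Balaban1984PropagatorsII, (2.4) p.224] -/
theorem tlAtlas_covers (L : ℕ) : (tlAtlas (d := d) (a := a) (b := b) L).Covers := by
  rintro (x | i)
  · exact ⟨false, zv x, zv_mem_Icc x, congrArg Sum.inl (clampBox_zv x)⟩
  · exact ⟨true, zv i, zv_mem_Icc i, congrArg Sum.inr (clampBox_zv i)⟩

/-- The two charts are linked (by the interface bond at the corner). [cite: Balaban1984PropagatorsII, (2.46) p.231] -/
theorem tlAtlas_linked (L : ℕ) : (tlAtlas (d := d) (a := a) (b := b) L).Linked false true := by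
  refine ⟨zv (0 : Fin d → Fin (a + 1)), zv (0 : Fin d → Fin (b + 1)), zv_mem_Icc 0, zv_mem_Icc 0, Or.inr ?_⟩
  show (graph L).Adj (Sum.inl (clampBox a (zv 0))) (Sum.inr (clampBox b (zv 0)))
  rw [clampBox_zv, clampBox_zv]
  exact adj_corner L

/-- The nerve of the atlas is preconnected. [folklore] -/
theorem tlAtlas_nerve_preconnected (L : ℕ) : (tlAtlas (d := d) (a := a) (b := b) L).nerve.Preconnected := by
  have hadj : (tlAtlas (d := d) (a := a) (b := b) L).nerve.Adj false true := by
    rw [B6BoxCharts.Atlas.nerve, SimpleGraph.fromRel_adj]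
    exact ⟨Bool.false_ne_true, Or.inl (tlAtlas_linked L)⟩
  rintro (_ | _) (_ | _)
  · exact SimpleGraph.Reachable.refl _
  · exact hadj.reachable
  · exact hadj.symm.reachable
  · exact SimpleGraph.Reachable.refl _

/- **Connectivity from block data** (`…B6BoxCharts.connected_of_atlas`): the two-level bond graph is connected — a
second proof of the landed `…B6CoverTwoLevel.graph_connected` (an `example`; cite the landed declaration).
[cite: Balaban1984PropagatorsII, p.231 + (2.4) p.224] -/
example (L : ℕ) : (graph L : SimpleGraph (TL d a b)).Connected :=
  haveI : Nonempty (TL d a b) := ⟨Sum.inl fun _ => 0⟩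
  connected_of_atlas (tlAtlas_covers L) (tlAtlas_nerve_preconnected L)

/-! ### (2.66) on the two-level model: d(y, y′) ≤ ‖x(y) − x(y′)‖₁ (fine units, across the interface too) and
‖x(y) − x(y′)‖₁ ≤ L·d(y, y′) -/

/-- In the fine box: d(y, y″) ≤ ‖x − x″‖₁ (Λ_j-units). [cite: Balaban1984PropagatorsII, (2.66) p.234 + (2.46) p.231] -/
theorem tdist_inl_inl_le (L : ℕ) (x x'' : Fin d → Fin (a + 1)) :
    tdist L (Sum.inl x : TL d a b) (Sum.inl x'') ≤ latL1Dist (zv x) (zv x'') := by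
  have := dist_le_latL1Dist_of_chart (chart_inl (d := d) (a := a) (b := b) L) (zv_mem_Icc x) (zv_mem_Icc x'')
  rw [clampBox_zv, clampBox_zv] at this
  unfold tdist
  exact_mod_cast this

/-- In the coarse box: d(y, y″) ≤ ‖i − i″‖₁ (Λ_{j+1}-units). [cite: Balaban1984PropagatorsII, (2.66) p.234 + (2.46) p.231] -/
theorem tdist_inr_inr_le (L : ℕ) (i i'' : Fin d → Fin (b + 1)) :
    tdist L (Sum.inr i : TL d a b) (Sum.inr i'') ≤ latL1Dist (zv i) (zv i'') := by
  have := dist_le_latL1Dist_of_chart (chart_inr (d := d) (a := a) (b := b) L) (zv_mem_Icc i) (zv_mem_Icc i'')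
  rw [clampBox_zv, clampBox_zv] at this
  unfold tdist
  exact_mod_cast this

/-- The coarse face index below i: v = (0, i₁, …, i_{d−1}). [folklore] -/
def faceIdx (i : Fin d → Fin (b + 1)) : Fin d → Fin (b + 1) := fun μ => if μ = 0 then 0 else i μ

/-- The fine face point above i: (0, L·i₁, …, L·i_{d−1}) ∈ ℤ^d. [folklore] -/
def facePt (L : ℕ) (i : Fin d → Fin (b + 1)) : Site d := fun μ => if μ = 0 then 0 else (L : ℤ) * ((i μ : ℕ) : ℤ)

/-- The fine face point lies in the fine box when L·i_μ ≤ a tangentially. [folklore] -/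
theorem facePt_mem {L : ℕ} {i : Fin d → Fin (b + 1)} (hfit : ∀ μ, μ ≠ 0 → L * (i μ : ℕ) ≤ a) :
    facePt L i ∈ Set.Icc (0 : Site d) (fun _ => (a : ℤ)) := by
  refine ⟨fun μ => ?_, fun μ => ?_⟩
  · by_cases hμ : μ = 0
    · simp [facePt, hμ]
    · simp only [facePt, hμ, if_false, Pi.zero_apply]; positivity
  · by_cases hμ : μ = 0
    · simp [facePt, hμ]
    · simp only [facePt, hμ, if_false]; exact_mod_cast hfit μ hμ

/-- The interface bond above i: the fine face point is bonded to the coarse face index. [cite: Balaban1984PropagatorsII, (2.46) p.231] -/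
theorem adj_face {L : ℕ} {i : Fin d → Fin (b + 1)} (hfit : ∀ μ, μ ≠ 0 → L * (i μ : ℕ) ≤ a) :
    (graph L).Adj (Sum.inl (clampBox a (facePt L i)) : TL d a b) (Sum.inr (clampBox b (zv (faceIdx i)))) := by
  rw [clampBox_zv, B6CoverTwoLevel.graph, SimpleGraph.fromRel_adj]
  refine ⟨Sum.inl_ne_inr, Or.inl ⟨?_, ?_, fun μ hμ => ?_⟩⟩
  · apply Fin.ext
    simp [clampBox, facePt]
  · simp [faceIdx]
  · have h1 : ((clampBox a (facePt L i) μ : ℕ) : ℤ) = facePt L i μ := congr_fun (zv_clampBox (facePt_mem hfit)) μ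
    rw [h1]
    simp [facePt, faceIdx, hμ]

omit [NeZero d] in
/-- The ℓ¹ lattice distance as an integer sum. [folklore] -/
theorem cast_latL1Dist (u v : Site d) : ((latL1Dist u v : ℕ) : ℤ) = ∑ μ, |u μ - v μ| := by
  simp [latL1Dist, Nat.cast_sum]

/-- **Across the interface**: for a fine site x and a coarse site i whose face point fits under the fine box,
d(x, i) ≤ ‖x(x) − x(i)‖₁ in Λ_j-units (staircase to the face point above i, the interface bond, the coarse staircase
(0, i′) → i — `…B6BoxCharts.dist_le_of_linked_at` — and i₀ ≤ L·i₀). [cite: Balaban1984PropagatorsII, (2.66) p.234 + (2.46) p.231] -/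
theorem tdist_inl_inr_le {L : ℕ} (hL : 1 ≤ L) (x : Fin d → Fin (a + 1)) (i : Fin d → Fin (b + 1))
    (hfit : ∀ μ, μ ≠ 0 → L * (i μ : ℕ) ≤ a) :
    tdist L (Sum.inl x : TL d a b) (Sum.inr i) ≤ latL1Dist (pos L (Sum.inl x : TL d a b)) (pos L (Sum.inr i : TL d a b)) := by
  have h1 : (graph L).dist (Sum.inl x : TL d a b) (Sum.inr i) ≤
      latL1Dist (zv x) (facePt L i) + 1 + latL1Dist (zv (faceIdx i)) (zv i) := by
    have := dist_le_of_linked_at (𝔄 := tlAtlas (d := d) (a := a) (b := b) L) (a := false) (a' := true)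
      (facePt_mem hfit) (zv_mem_Icc (faceIdx i)) (Or.inr (adj_face hfit)) (zv_mem_Icc x) (zv_mem_Icc i)
    simpa [tlAtlas, clampBox_zv] using this
  unfold tdist
  have h2 : ((latL1Dist (zv x) (facePt L i) + 1 + latL1Dist (zv (faceIdx i)) (zv i) : ℕ) : ℤ) ≤
      latL1Dist (pos L (Sum.inl x : TL d a b)) (pos L (Sum.inr i : TL d a b)) := by
    push_cast
    rw [cast_latL1Dist, cast_latL1Dist, cast_latL1Dist,
      ← Finset.add_sum_erase _ _ (mem_univ (0 : Fin d)), ← Finset.add_sum_erase _ _ (mem_univ (0 : Fin d)),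
      ← Finset.add_sum_erase _ (fun μ => |pos L (Sum.inl x : TL d a b) μ - pos L (Sum.inr i : TL d a b) μ|)
        (mem_univ (0 : Fin d))]
    have e1 : ∑ μ ∈ univ.erase (0 : Fin d), |zv (faceIdx i) μ - zv i μ| = 0 :=
      Finset.sum_eq_zero fun μ hμ => by simp [zv, faceIdx, (Finset.mem_erase.mp hμ).1]
    have e2 : ∑ μ ∈ univ.erase (0 : Fin d), |zv x μ - facePt L i μ| =
        ∑ μ ∈ univ.erase (0 : Fin d), |pos L (Sum.inl x : TL d a b) μ - pos L (Sum.inr i : TL d a b) μ| :=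
      Finset.sum_congr rfl fun μ hμ => by
        rw [pos_inl, pos_inr_of_ne L i (Finset.mem_erase.mp hμ).1]
        simp [facePt, (Finset.mem_erase.mp hμ).1]
    rw [e1, e2, pos_inl, pos_inr_zero]
    have hx0 : (0 : ℤ) ≤ zv x 0 := Int.natCast_nonneg _
    have hi0 : (0 : ℤ) ≤ ((i 0 : ℕ) : ℤ) := Int.natCast_nonneg _
    have hL' : (1 : ℤ) ≤ L := by exact_mod_cast hL
    have t1 : |zv x 0 - facePt L i 0| = zv x 0 := by simp [facePt, abs_of_nonneg hx0]
    have t2 : |zv (faceIdx i) 0 - zv i 0| = ((i 0 : ℕ) : ℤ) := by simp [zv, faceIdx, abs_of_nonneg hi0]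
    have t3 : |zv x 0 - (-1 - (L : ℤ) * ((i 0 : ℕ) : ℤ))| = zv x 0 + 1 + (L : ℤ) * ((i 0 : ℕ) : ℤ) := by
      rw [abs_of_nonneg (by nlinarith)]; ring
    rw [t1, t2, t3]
    nlinarith
  exact_mod_cast h1.trans (by exact_mod_cast h2)

/-- The ℓ¹ distance of two coarse positions is L times that of their indices. [folklore] -/
theorem latL1Dist_zv_le_latL1Dist_pos {L : ℕ} (hL : 1 ≤ L) (i i'' : Fin d → Fin (b + 1)) :
    latL1Dist (zv i) (zv i'') ≤ latL1Dist (pos L (Sum.inr i : TL d a b)) (pos L (Sum.inr i'' : TL d a b)) := by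
  unfold latL1Dist
  refine Finset.sum_le_sum fun μ _ => ?_
  have key : (pos L (Sum.inr i : TL d a b) μ - pos L (Sum.inr i'' : TL d a b) μ).natAbs =
      L * (zv i μ - zv i'' μ).natAbs := by
    by_cases hμ : μ = 0
    · subst hμ
      rw [pos_inr_zero, pos_inr_zero,
        show -1 - (L : ℤ) * ((i 0 : ℕ) : ℤ) - (-1 - (L : ℤ) * ((i'' 0 : ℕ) : ℤ)) = -((L : ℤ) * (zv i 0 - zv i'' 0)) by
          simp only [zv]; ring, Int.natAbs_neg, Int.natAbs_mul, Int.natAbs_natCast]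
    · rw [pos_inr_of_ne L i hμ, pos_inr_of_ne L i'' hμ,
        show (L : ℤ) * ((i μ : ℕ) : ℤ) - (L : ℤ) * ((i'' μ : ℕ) : ℤ) = (L : ℤ) * (zv i μ - zv i'' μ) by
          simp only [zv]; ring, Int.natAbs_mul, Int.natAbs_natCast]
  rw [key]
  exact Nat.le_mul_of_pos_left _ hL

/-- **(2.66) on the two-level model, upper comparison, O(1) = 1**: if the coarse box lies under the fine box
(L·b ≤ a), then for ALL y, y′ (same level or across the interface) d(y, y′) ≤ ‖x(y) − x(y′)‖₁ in Λ_j-units =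
(L^jη)^{−1}|y − y′|₁. [cite: Balaban1984PropagatorsII, (2.66) p.234 + (2.46) p.231] -/
theorem tdist_le_latL1Dist_pos {L : ℕ} (hL : 1 ≤ L) (hab : L * b ≤ a) (y y' : TL d a b) :
    tdist L y y' ≤ latL1Dist (pos L y) (pos L y') := by
  have hfit : ∀ (i : Fin d → Fin (b + 1)) (μ : Fin d), μ ≠ 0 → L * (i μ : ℕ) ≤ a :=
    fun i μ _ => (Nat.mul_le_mul_left L (Nat.lt_succ_iff.mp (i μ).isLt)).trans hab
  rcases y with x | i <;> rcases y' with x' | i'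
  · simpa [pos_inl] using tdist_inl_inl_le (b := b) L x x'
  · exact tdist_inl_inr_le hL x i' (hfit i')
  · rw [tdist_comm, latL1Dist_comm]; exact tdist_inl_inr_le hL x' i (hfit i)
  · exact (tdist_inr_inr_le (a := a) L i i').trans (by exact_mod_cast latL1Dist_zv_le_latL1Dist_pos (a := a) hL i i')

/-- **The lower comparison (the mechanism of (2.48)) on the two-level model**: ‖x(y) − x(y′)‖₁ ≤ L·d(y, y′), i.e.
(L^{j+1}η)^{−1}|y − y′|₁ ≤ d(y, y′) (every bond has Λ_j-length ≤ L). [cite: Balaban1984PropagatorsII, (2.48) p.232 + (2.46) p.231] -/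
theorem latL1Dist_pos_le {L : ℕ} (hL : 1 ≤ L) (y y' : TL d a b) :
    (latL1Dist (pos L y) (pos L y') : ℝ) ≤ L * tdist L y y' := by
  have key : ∀ s : TL d a b,
      |(∑ μ, |ff L y μ - ff L s μ|) - (∑ μ, |ff L y' μ - ff L s μ|)| ≤ L * tdist L y y' := by
    intro s
    have hΦ : ∀ z z' : TL d a b, (graph L).Adj z z' →
        |(∑ μ, |ff L z μ - ff L s μ|) - (∑ μ, |ff L z' μ - ff L s μ|)| ≤ L := by
      intro z z' h
      calc |(∑ μ, |ff L z μ - ff L s μ|) - (∑ μ, |ff L z' μ - ff L s μ|)|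
          = |∑ μ, (|ff L z μ - ff L s μ| - |ff L z' μ - ff L s μ|)| := by rw [Finset.sum_sub_distrib]
        _ ≤ ∑ μ, |(|ff L z μ - ff L s μ| - |ff L z' μ - ff L s μ|)| := Finset.abs_sum_le_sum_abs _ _
        _ ≤ ∑ μ, |ff L z μ - ff L z' μ| := Finset.sum_le_sum fun μ _ => by
            have := abs_abs_sub_abs_le_abs_sub (ff L z μ - ff L s μ) (ff L z' μ - ff L s μ)
            rwa [sub_sub_sub_cancel_right] at this
        _ ≤ L := sum_abs_ff_sub_le_of_adj hL h
    exact abs_sub_le_mul_tdist L (Φ := fun z => ∑ μ, |ff L z μ - ff L s μ|) hΦ y y'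
  have h := key y'
  simp only [sub_self, abs_zero, Finset.sum_const_zero, sub_zero] at h
  calc (latL1Dist (pos L y) (pos L y') : ℝ) = ∑ μ, |ff L y μ - ff L y' μ| := by
        simp only [latL1Dist, ff, Nat.cast_sum, Nat.cast_natAbs, Int.cast_abs, Int.cast_sub]
    _ ≤ L * tdist L y y' := (le_abs_self _).trans h

/-- **(2.66) on the two-level model, both ways**: (L^{j+1}η)^{−1}|y − y′|₁ ≤ d(y, y′) ≤ (L^jη)^{−1}|y − y′|₁ for all
pairs of sites, the upper bound needing the coarse box under the fine one (L·b ≤ a), L ≥ 1.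
[cite: Balaban1984PropagatorsII, (2.66) p.234 + (2.48) p.232 + (2.46) p.231] -/
theorem comparison266 {L : ℕ} (hL : 1 ≤ L) (hab : L * b ≤ a) (y y' : TL d a b) :
    (latL1Dist (pos L y) (pos L y') : ℝ) / L ≤ tdist L y y' ∧ tdist L y y' ≤ latL1Dist (pos L y) (pos L y') := by
  have hL' : (0 : ℝ) < L := by exact_mod_cast hL
  exact ⟨(div_le_iff₀' hL').2 (latL1Dist_pos_le hL y y'), by exact_mod_cast tdist_le_latL1Dist_pos hL hab y y'⟩

end TwoLevel

/-! ## §4  Proposition 2.7 at power p on the two coordinatised cover models (the cover ∕ metric binders discharged) -/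

section Prop27Box

variable (d n m j kk : ℕ) (L η R : ℝ)

open B6CoverBox (boxGeo Kbox Kbox_nonneg boxGeo_levelSep boxGeo_ineq261With boxGeo_ineq263With hprof cubeInd
  sum_hprof_sq card_filter_hprof_ne_zero_le abs_hprof_sub_le cubeInd_zero_or_one cubeInd_mul_hprof gap_of_cubeInd_eq_zero)

/-- **Proposition 2.7 ∕ 2.3 at power p on the one-level box model** — `…B6Prop27Kernel.inverse_assembled_pow` (p = 2:
the inverse of QGQ*, (2.149); p = 4: Proposition 2.3, by `K285P_four`) on `boxGeo` with D = the cube centres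
{0, …, n}^d, □_i = `cubeInd m i`, h_□ = `hprof m i`, j_□ = j: the metric binders htri ∕ hrefl ∕ hd SUPPLIED BY THE
REALISATION (2.46) (`boxGeo_realizes` via `…B6Geometry`), hsep ∕ h261σ ∕ h261 ∕ h263 ∕ hc by `…B6CoverBox`, and the
cover binders hover (n₀ = 2^d), hpf01, hph, h236, hLip (s = 3π∕2), hcube, hlev, hgap (m_g = ⅓) DISCHARGED; the model needs
M = m ≥ 1, L ≥ 1, η > 0, RM ≥ 0 and 0 < δ₁, 0 < σδ₀ (the two (2.61)-constants are K(σδ₀), K(δ₁∕2)).  Kept VERBATIM: the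
rates and their split, the threshold L^p ≤ e^{⅛δ₀RM}, the kernels X, X̃_i, C_i with their (2.76)∕(2.142)-type majorants
hX ∕ hXw, the change-of-domain majorant hdom, the cube inverse bound h2148 ((2.81) ∕ (2.148)), hCk0, (2.70) h270, and
«M large» hKM with the model's constants; conclusion verbatim (two-sided inverse, glued form (2.86), uniqueness, the
kernel bound (2.87) ∕ (2.149) at power p). [cite: Balaban1984PropagatorsII, Prop. 2.7 (2.143)–(2.149) pp.248–249 + Prop. 2.3 (2.82)–(2.87) pp.237–238] -/
theorem inverse_assembled_pow_box (p : ℕ) (hm : 0 < m) (hL : 1 ≤ L) (hη : 0 < η) (hRM : 0 ≤ R * m)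
    {δ₀ δ₁ σ c₃ BX BD BC : ℝ} (hδ₀ : 0 < δ₀) (hδ₁ : 0 < δ₁) (hsplit : δ₁ + σ * δ₀ ≤ δ₀ / 4) (hσ : 0 < σ * δ₀)
    (hthr : L ^ p ≤ Real.exp (1 / 8 * δ₀ * R * m)) (hc₃ : 0 < c₃) (hBX : 0 ≤ BX) (hBD : 0 ≤ BD) (hBC : 0 ≤ BC)
    {X : (boxGeo d n m j kk L η R).Site → (boxGeo d n m j kk L η R).Site → ℝ}
    {Xw Ck : (Fin d → Fin (n + 1)) → (boxGeo d n m j kk L η R).Site → (boxGeo d n m j kk L η R).Site → ℝ}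
    (hX : ∀ y y'', |(boxGeo d n m j kk L η R).len y'' ^ d * X y y''| ≤
      BX * (boxGeo d n m j kk L η R).len y ^ p * Real.exp (-(1 / 2 * δ₀ * (boxGeo d n m j kk L η R).dist y y'')))
    (hXw : ∀ i y y'', |(boxGeo d n m j kk L η R).len y'' ^ d * Xw i y y''| ≤
      BX * (boxGeo d n m j kk L η R).len y ^ p * Real.exp (-(1 / 2 * δ₀ * (boxGeo d n m j kk L η R).dist y y'')))
    (hdom : ∀ i y y'', |cubeInd m i y * ((boxGeo d n m j kk L η R).len y'' ^ d * (Xw i y y'' - X y y'')) * hprof m i y''| ≤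
      BD * Real.exp (-(c₃ * (boxGeo d n m j kk L η R).M)) * (boxGeo d n m j kk L η R).len y ^ p *
        Real.exp (-(1 / 2 * δ₀ * (boxGeo d n m j kk L η R).dist y y'')))
    (h2148 : ∀ i y y', cubeInd m i y ≠ 0 → cubeInd m i y' ≠ 0 →
      |Ck i y y'| ≤ BC / ((boxGeo d n m j kk L η R).L ^ j * (boxGeo d n m j kk L η R).eta) ^ (d + p) *
        Real.exp (-(δ₁ * (boxGeo d n m j kk L η R).dist y y')))
    (hCk0 : ∀ i y'' y', cubeInd m i y'' = 0 → Ck i y'' y' = 0)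
    (h270 : ∀ i, locOp (fun i => B6Expansion282.mulOp (cubeInd m i))
        (fun i => kerOp (fun z => (boxGeo d n m j kk L η R).len z ^ d) (Xw i)) i *
      kerOp (fun z => (boxGeo d n m j kk L η R).len z ^ d) (Ck i) * B6Expansion282.mulOp (hprof m i) =
        B6Expansion282.mulOp (hprof m i))
    (hKM : 2 * K285P (boxGeo d n m j kk L η R) d p (2 ^ d) (3 * π / 2) δ₀ (Kbox d (σ * δ₀)) c₃ (1 / 3) BX BD BC *
      Kbox d (1 / 2 * δ₁) ≤ (boxGeo d n m j kk L η R).M) :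
    ∃ G : Module.End ℝ ((boxGeo d n m j kk L η R).Site → ℝ),
      G * kerOp (fun z => (boxGeo d n m j kk L η R).len z ^ d) X = 1 ∧
      kerOp (fun z => (boxGeo d n m j kk L η R).len z ^ d) X * G = 1 ∧
      G = Cglued (fun i => B6Expansion282.mulOp (hprof m i))
          (fun i => kerOp (fun z => (boxGeo d n m j kk L η R).len z ^ d) (Ck i)) +
        G * R282 (kerOp (fun z => (boxGeo d n m j kk L η R).len z ^ d) X) (fun i => B6Expansion282.mulOp (cubeInd m i))
          (fun i => kerOp (fun z => (boxGeo d n m j kk L η R).len z ^ d) (Xw i)) (fun i => B6Expansion282.mulOp (hprof m i))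
          (fun i => kerOp (fun z => (boxGeo d n m j kk L η R).len z ^ d) (Ck i)) ∧
      (∀ G' : Module.End ℝ ((boxGeo d n m j kk L η R).Site → ℝ),
        G' * kerOp (fun z => (boxGeo d n m j kk L η R).len z ^ d) X = 1 → G' = G) ∧
      ∀ y y', |mat G y y' / (boxGeo d n m j kk L η R).len y' ^ d| ≤
        2 * ((2 ^ d : ℕ) * (BC * (boxGeo d n m j kk L η R).L ^ (d + p))) * Kbox d (1 / 2 * δ₁) *
          (boxGeo d n m j kk L η R).len y ^ (-(p : ℝ)) * (boxGeo d n m j kk L η R).len y' ^ (-(d : ℝ)) *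
          Real.exp (-(δ₁ / 2 * (boxGeo d n m j kk L η R).dist y y')) := by
  have hM : 0 < (boxGeo d n m j kk L η R).M := by
    show (0 : ℝ) < m
    exact_mod_cast hm
  have hδhalf : 0 < 1 / 2 * δ₁ := by linarith
  exact inverse_assembled_pow (g := boxGeo d n m j kk L η R) (D := Fin d → Fin (n + 1)) (pf := cubeInd m)
    (hf := hprof m) (js := fun _ => j) (n₀ := 2 ^ d) d p
    (triangle254_of_realizes (boxGeo_realizes d n m j kk L η R) (boxCS_connected d n m j kk L η R))
    (dist_self_of_realizes (boxGeo_realizes d n m j kk L η R))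
    (dist_nonneg_of_realizes (boxGeo_realizes d n m j kk L η R))
    (boxGeo_levelSep d n m j kk L η R) hL hη hM hRM hδ₀ hδ₁.le hsplit (boxGeo_ineq261With d n m j kk L η R hσ) hthr
    (boxGeo_ineq261With d n m j kk L η R hδhalf) (boxGeo_ineq263With d n m j kk L η R hδhalf hδ₁.le (by norm_num))
    (Kbox_nonneg d hδhalf) hc₃ (by positivity) (by norm_num) hBX hBD hBC
    (fun y => card_filter_hprof_ne_zero_le hm y) (cubeInd_zero_or_one m) (cubeInd_mul_hprof hm) (sum_hprof_sq hm)
    (abs_hprof_sub_le hm) (fun _ _ _ => ⟨le_rfl, Nat.le_succ _⟩) (fun _ _ _ _ _ => rfl)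
    (fun _ _ _ hy hy'' => gap_of_cubeInd_eq_zero hm hy hy'') hX hXw hdom h2148 hCk0 h270 hKM

end Prop27Box

section Prop27TwoLevel

variable (d : ℕ) [NeZero d] (nf nc m L j kk : ℕ) (η R : ℝ)

open B6CoverTwoLevel (TL tlGeo tlGeo_levelSep tlGeo_ineq261With tlGeo_ineq263With Ktl Ktl_nonneg Idx hfun cubeInd
  sum_hfun_sq card_filter_hfun_ne_zero_le abs_hfun_sub_le cubeInd_zero_or_one cubeInd_mul_hfun gap_of_cubeInd_eq_zero)

/-- **Proposition 2.7 ∕ 2.3 at power p on the two-level cover model** — `…B6Prop27TwoLevel.inverse_assembled_pow_twoLevel`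
(the chain WITHOUT the single-level hypothesis hlev; p = 2: (2.149); p = 4: Proposition 2.3 by `K285TLP_four`) on
`tlGeo` with D = `Idx d n_f n_c` (fine ⊕ coarse centres), □_i = `cubeInd m L i`, h_□ = `hfun n_f n_c m L i`, j_□ = j for
every cube: htri ∕ hrefl ∕ hd SUPPLIED BY THE REALISATION (2.46) (`tlGeo_realizes`), hsep ∕ h261σ ∕ h261 ∕ h263 ∕ hc by
`…B6CoverTwoLevel`, and hover (n₀ = 2^d + 2^d), hpf01, hph, h236, hLip (s = (1 + 2^{d+2})(3π∕2)L), hcube, hgap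
(m_g = 1∕(3L)) DISCHARGED; the model needs M = m ≥ 1, L ∈ ℕ with L ≥ 2, η > 0, RM ≥ 0, 0 < δ₁, 0 < σδ₀.  Kept VERBATIM:
the rates and their split, L^p ≤ e^{⅛δ₀RM}, the kernels with hX ∕ hXw ∕ hdom ∕ h2148 ∕ hCk0 ∕ h270, «M large» hKM with
the model's constants (K = `K285TLP`); conclusion verbatim. [cite: Balaban1984PropagatorsII, Prop. 2.7 (2.143)–(2.149) pp.248–249 + Prop. 2.3 (2.82)–(2.87) pp.237–238] -/
theorem inverse_assembled_pow_twoLevelBox (p : ℕ) (hm : 0 < m) (hL2 : 2 ≤ L) (hη : 0 < η) (hRM : 0 ≤ R * m)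
    {δ₀ δ₁ σ c₃ BX BD BC : ℝ} (hδ₀ : 0 < δ₀) (hδ₁ : 0 < δ₁) (hsplit : δ₁ + σ * δ₀ ≤ δ₀ / 4) (hσ : 0 < σ * δ₀)
    (hthr : (L : ℝ) ^ p ≤ Real.exp (1 / 8 * δ₀ * R * m)) (hc₃ : 0 < c₃) (hBX : 0 ≤ BX) (hBD : 0 ≤ BD) (hBC : 0 ≤ BC)
    {X : (tlGeo d nf nc m L j kk η R).Site → (tlGeo d nf nc m L j kk η R).Site → ℝ}
    {Xw Ck : Idx d nf nc → (tlGeo d nf nc m L j kk η R).Site → (tlGeo d nf nc m L j kk η R).Site → ℝ}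
    (hX : ∀ y y'', |(tlGeo d nf nc m L j kk η R).len y'' ^ d * X y y''| ≤
      BX * (tlGeo d nf nc m L j kk η R).len y ^ p * Real.exp (-(1 / 2 * δ₀ * (tlGeo d nf nc m L j kk η R).dist y y'')))
    (hXw : ∀ i y y'', |(tlGeo d nf nc m L j kk η R).len y'' ^ d * Xw i y y''| ≤
      BX * (tlGeo d nf nc m L j kk η R).len y ^ p * Real.exp (-(1 / 2 * δ₀ * (tlGeo d nf nc m L j kk η R).dist y y'')))
    (hdom : ∀ i y y'', |cubeInd m L i y * ((tlGeo d nf nc m L j kk η R).len y'' ^ d * (Xw i y y'' - X y y'')) *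
        hfun nf nc m L i y''| ≤
      BD * Real.exp (-(c₃ * (tlGeo d nf nc m L j kk η R).M)) * (tlGeo d nf nc m L j kk η R).len y ^ p *
        Real.exp (-(1 / 2 * δ₀ * (tlGeo d nf nc m L j kk η R).dist y y'')))
    (h2148 : ∀ i y y', cubeInd m L i y ≠ 0 → cubeInd m L i y' ≠ 0 →
      |Ck i y y'| ≤ BC / ((tlGeo d nf nc m L j kk η R).L ^ j * (tlGeo d nf nc m L j kk η R).eta) ^ (d + p) *
        Real.exp (-(δ₁ * (tlGeo d nf nc m L j kk η R).dist y y')))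
    (hCk0 : ∀ i y'' y', cubeInd m L i y'' = 0 → Ck i y'' y' = 0)
    (h270 : ∀ i, locOp (fun i => B6Expansion282.mulOp (cubeInd m L i))
        (fun i => kerOp (fun z => (tlGeo d nf nc m L j kk η R).len z ^ d) (Xw i)) i *
      kerOp (fun z => (tlGeo d nf nc m L j kk η R).len z ^ d) (Ck i) * B6Expansion282.mulOp (hfun nf nc m L i) =
        B6Expansion282.mulOp (hfun nf nc m L i))
    (hKM : 2 * K285TLP (tlGeo d nf nc m L j kk η R) d p (2 ^ d + 2 ^ d) ((1 + 2 ^ (d + 2)) * (3 * π / 2) * L) δ₀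
      (Ktl d (σ * δ₀)) c₃ (1 / (3 * (L : ℝ))) BX BD BC * Ktl d (1 / 2 * δ₁) ≤ (tlGeo d nf nc m L j kk η R).M) :
    ∃ G : Module.End ℝ ((tlGeo d nf nc m L j kk η R).Site → ℝ),
      G * kerOp (fun z => (tlGeo d nf nc m L j kk η R).len z ^ d) X = 1 ∧
      kerOp (fun z => (tlGeo d nf nc m L j kk η R).len z ^ d) X * G = 1 ∧
      G = Cglued (fun i => B6Expansion282.mulOp (hfun nf nc m L i))
          (fun i => kerOp (fun z => (tlGeo d nf nc m L j kk η R).len z ^ d) (Ck i)) +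
        G * R282 (kerOp (fun z => (tlGeo d nf nc m L j kk η R).len z ^ d) X) (fun i => B6Expansion282.mulOp (cubeInd m L i))
          (fun i => kerOp (fun z => (tlGeo d nf nc m L j kk η R).len z ^ d) (Xw i))
          (fun i => B6Expansion282.mulOp (hfun nf nc m L i))
          (fun i => kerOp (fun z => (tlGeo d nf nc m L j kk η R).len z ^ d) (Ck i)) ∧
      (∀ G' : Module.End ℝ ((tlGeo d nf nc m L j kk η R).Site → ℝ),
        G' * kerOp (fun z => (tlGeo d nf nc m L j kk η R).len z ^ d) X = 1 → G' = G) ∧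
      ∀ y y', |mat G y y' / (tlGeo d nf nc m L j kk η R).len y' ^ d| ≤
        2 * ((2 ^ d + 2 ^ d : ℕ) * (BC * (tlGeo d nf nc m L j kk η R).L ^ (d + p))) * Ktl d (1 / 2 * δ₁) *
          (tlGeo d nf nc m L j kk η R).len y ^ (-(p : ℝ)) * (tlGeo d nf nc m L j kk η R).len y' ^ (-(d : ℝ)) *
          Real.exp (-(δ₁ / 2 * (tlGeo d nf nc m L j kk η R).dist y y')) := by
  have hL1 : 1 ≤ L := le_trans (by norm_num) hL2
  have hL0 : 0 < L := hL1
  have hLr : (1 : ℝ) ≤ (L : ℝ) := by exact_mod_cast hL1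
  have hM : 0 < (tlGeo d nf nc m L j kk η R).M := by
    show (0 : ℝ) < m
    exact_mod_cast hm
  have hδhalf : 0 < 1 / 2 * δ₁ := by linarith
  exact inverse_assembled_pow_twoLevel (g := tlGeo d nf nc m L j kk η R) (D := Idx d nf nc) (pf := cubeInd m L)
    (hf := hfun nf nc m L) (js := fun _ => j) (n₀ := 2 ^ d + 2 ^ d) d p
    (triangle254_of_realizes (tlGeo_realizes d nf nc m L j kk η R) (tlCS_connected d nf nc m L j kk η R))
    (dist_self_of_realizes (tlGeo_realizes d nf nc m L j kk η R))
    (dist_nonneg_of_realizes (tlGeo_realizes d nf nc m L j kk η R))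
    (tlGeo_levelSep d nf nc m L j kk η R) hLr hη hM hRM hδ₀ hδ₁.le hsplit
    (tlGeo_ineq261With d nf nc m L j kk η R hL2 hσ) hthr
    (tlGeo_ineq261With d nf nc m L j kk η R hL2 hδhalf)
    (tlGeo_ineq263With d nf nc m L j kk η R hL2 hδhalf hδ₁.le (by norm_num)) (Ktl_nonneg d _) hc₃
    (by positivity) (by positivity) hBX hBD hBC
    (fun y => card_filter_hfun_ne_zero_le hm L y) (cubeInd_zero_or_one m L) (cubeInd_mul_hfun hm L)
    (sum_hfun_sq hm hL0) (abs_hfun_sub_le hm hL1)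
    (fun i y _ => by rcases y with x | i' <;> simp)
    (fun _ _ _ hy hy'' => gap_of_cubeInd_eq_zero hm hL1 hy hy'') hX hXw hdom h2148 hCk0 h270 hKM

end Prop27TwoLevel

/-! ## §5  The side conditions hold together -/

/-- The side conditions used above are jointly satisfiable together with those of the two cover models — d = 1, M = 4,
n_f = 10, n_c = 5, n = 5, L = 2 (so L·n_c ≤ n_f: the coarse box lies under the fine box), η = 1, R = 0 — and on that
instance both models realise (2.46), the two-level bond graph is connected from block data, (len) holds and (2.66)
holds both ways. [folklore] -/
theorem coverRealizes_nonvacuous :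
    ∃ d nf nc n m L : ℕ, ∃ _ : NeZero d, 0 < m ∧ 5 ≤ nf ∧ 5 ≤ nc ∧ 5 ≤ n ∧ 2 ≤ L ∧ L * (nc * m) ≤ nf * m ∧
      Realizes (B6CoverBox.boxGeo d n m 0 0 (L : ℝ) 1 0) (boxCS d n m 0 0 (L : ℝ) 1 0) ∧
      Realizes (B6CoverTwoLevel.tlGeo d nf nc m L 0 0 1 0) (tlCS d nf nc m L 0 0 1 0) ∧
      (B6CoverTwoLevel.graph L : SimpleGraph (B6CoverTwoLevel.TL d (nf * m) (nc * m))).Connected ∧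
      BondScale22 (tlCS d nf nc m L 0 0 1 0) (posR L 0 1) ∧
      ∀ y y' : B6CoverTwoLevel.TL d (nf * m) (nc * m),
        (latL1Dist (B6CoverTwoLevel.pos L y) (B6CoverTwoLevel.pos L y') : ℝ) / L ≤ B6CoverTwoLevel.tdist L y y' ∧
          B6CoverTwoLevel.tdist L y y' ≤ latL1Dist (B6CoverTwoLevel.pos L y) (B6CoverTwoLevel.pos L y') := by
  refine ⟨1, 10, 5, 5, 4, 2, inferInstance, by norm_num, by norm_num, le_rfl, le_rfl, le_rfl, by norm_num,
    boxGeo_realizes 1 5 4 0 0 2 1 0, tlGeo_realizes 1 10 5 4 2 0 0 1 0, ?_,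
    tlCS_bondScale22 1 10 5 4 2 0 0 1 0 zero_le_one, fun y y' => comparison266 (by norm_num) (by norm_num) y y'⟩
  haveI : Nonempty (B6CoverTwoLevel.TL 1 (10 * 4) (5 * 4)) := ⟨Sum.inl fun _ => 0⟩
  exact connected_of_atlas (tlAtlas_covers 2) (tlAtlas_nerve_preconnected 2)

end Literature.MathematicalPhysics.QuantumFieldTheory.Balaban1983to89.B6CoverRealizes
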